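import Literature.AlgebraicGeometry.Resolution.Hironaka1964LocalLU
import Literature.AlgebraicGeometry.Resolution.ExcellentRingsCompleteHolds
import HarnessLib

/-!
# (LU) for complete local domains of residue characteristic zero: trust base `Hironaka1964_local`

Topic: `Literature/AlgebraicGeometry/Resolution` (proofs only; no new notions, no new named
facts). The named fact `CossartPiltant2019LUCompleteChar0` (`ArithmeticalThreefoldsLocal.lean`;
Cossart–Piltant 2019, proof of journal Prop. 4.10 = arXiv v1 Prop. 4.8, first paragraph: "it is
sufficient to prove that (LU) holds for every complete local domain `(A,m,k)` of dimension
three. … We may assume here that `char k_v = p > 0`, the equicharacteristic zero version of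
theorem 1.1 being known") was reduced in `Hironaka1964LocalLU.lean` to two leaves,
`luCompleteChar0_of_hironaka1964_local : Hironaka1964_local → Stacks07QW_complete →
CossartPiltant2019LUCompleteChar0`. The second leaf is now PROVED
(`Stacks07QW_complete_holds`, `ExcellentRingsCompleteHolds.lean`: complete Noetherian local rings
are excellent, Stacks 07QW (2) / Matsumura §32), so the fact — and with it the
characteristic-zero leaf of the assembly of `CossartPiltant2019` — rests on the SINGLE leaf
`Hironaka1964_local` (Hironaka 1964, Main Theorem I over local quasi-excellent rings of residue
characteristic zero, `Temkin2008Localization.lean`). This file records that: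

* `Hironaka1964_local.cpLocalUniformization_of_isAdicComplete` — (LU) for every complete
  Noetherian local domain of residue characteristic zero, in any dimension, from
  `Hironaka1964_local` alone;
* `CossartPiltant2019LUCompleteChar0.of_hironaka1964_local : Hironaka1964_local →
  CossartPiltant2019LUCompleteChar0` — so the discharge `CossartPiltant2019LUCompleteChar0_holds`
  is the one-liner `.of_hironaka1964_local Hironaka1964_local_holds` once Hironaka's theorem is
  proved;
* `cossartPiltant2019_of_local''' ` — the assembly `cossartPiltant2019_of_local''` with the
  hypothesis `Stacks07QW_complete` discharged: trust base
  {`CossartPiltant2019Local`, `CossartPiltant2019ReductionP`, `Hironaka1964_local`,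
  `CossartPiltant2019LU3OfComplete`, `CossartJannsenSaito2020`, `CossartPiltant2019Patching`}.

## Sources

* V. Cossart, O. Piltant, *Resolution of singularities of arithmetical threefolds*, J. Algebra
  529 (2019) 268–535 = arXiv:1412.0868, proof of Prop. 4.10 (arXiv v1: Prop. 4.8, p. 53), first
  paragraph; §4.1 (LU). [CossartPiltant2019]
* H. Hironaka, Ann. of Math. 79 (1964), Main Theorem I; read as in M. Temkin, Adv. Math. 219
  (2008), p. 3 and Thm. 2.3.6. [Hironaka1964] [Temkin2008]
* The Stacks Project, Tag 07QW (2). [StacksProject]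
-/

noncomputable section

open IsLocalRing

namespace Literature.AlgebraicGeometry.Resolution

universe u

/-- **(LU) for complete Noetherian local domains of residue characteristic zero, any dimension,
from Hironaka's theorem alone**: a complete Noetherian local ring is excellent
(`Stacks07QW_complete_holds`), in particular quasi-excellent, so
`Hironaka1964_local.cpLocalUniformization` applies.
[cite: CossartPiltant2019, proof of Prop. 4.10 (arXiv v1: Prop. 4.8), first paragraph] -/
theorem Hironaka1964_local.cpLocalUniformization_of_isAdicComplete (hH : Hironaka1964_local.{u})
    (A : Type u) [CommRing A] [IsDomain A] [IsLocalRing A] [IsNoetherianRing A]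
    [IsAdicComplete (maximalIdeal A) A] (h0 : CharZero (ResidueField A)) :
    CPLocalUniformization A :=
  hH.cpLocalUniformization A (Stacks07QW_complete_holds A).isQuasiExcellentRing h0

/-- **`Hironaka1964_local → CossartPiltant2019LUCompleteChar0`**: the named fact
`CossartPiltant2019LUCompleteChar0` ((LU) for complete Noetherian local domains of Krull
dimension `3` with residue field of characteristic `0`) rests on the single leaf
`Hironaka1964_local`, the excellence of complete Noetherian local rings being proved
(`Stacks07QW_complete_holds`). The discharge `CossartPiltant2019LUCompleteChar0_holds` is
`CossartPiltant2019LUCompleteChar0.of_hironaka1964_local Hironaka1964_local_holds` once the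
leaf is proved.
[cite: CossartPiltant2019, proof of Prop. 4.10 (arXiv v1: Prop. 4.8), first paragraph] -/
theorem CossartPiltant2019LUCompleteChar0.of_hironaka1964_local (hH : Hironaka1964_local.{u}) :
    CossartPiltant2019LUCompleteChar0.{u} :=
  luCompleteChar0_of_hironaka1964_local hH Stacks07QW_complete_holds

/-- **Assembly of `CossartPiltant2019` with the characteristic-zero leaf re-rooted in
Hironaka's theorem and the excellence of complete local rings discharged**: as
`cossartPiltant2019_of_local''` (`Hironaka1964LocalLU.lean`) without the hypothesis
`Stacks07QW_complete`. [cite: CossartPiltant2019, Ch. 4] -/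
theorem cossartPiltant2019_of_local''' (hloc : CossartPiltant2019Local.{u})
    (hred : CossartPiltant2019ReductionP.{u}) (hH : Hironaka1964_local.{u})
    (h48 : CossartPiltant2019LU3OfComplete.{u}) (hCJS : CossartJannsenSaito2020.{u})
    (hP : CossartPiltant2019Patching.{u}) : CossartPiltant2019.{u} :=
  cossartPiltant2019_of_local'' hloc hred hH Stacks07QW_complete_holds h48 hCJS hP

/-! ## Fact decomposition record (librarian `fact-decompose`, 2026-08-16) -/

/-- **Assembly of the split of `CossartPiltant2019LUCompleteChar0`** (budget-capped fact;
human ruling 2026-08-16): its single child is the named leaf `Hironaka1964_local` (Hironaka 1964,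
Main Theorem I for local quasi-excellent rings of residue characteristic zero, as read by Temkin
2008, Thm. 2.3.6; `Temkin2008Localization.lean`), the excellence of complete local rings being the
theorem `Stacks07QW_complete_holds`; the glue is `CossartPiltant2019LUCompleteChar0.of_hironaka1964_local`.
The second road of the tree — Cossart–Piltant's own climb at residue characteristic `0` from the
characteristic-free inputs (C3) tame ascent, (C4) descent, (C5) reduction to rank one
(`CossartPiltant2019LUCompleteChar0.of_principalization`, `ArithmeticalThreefoldsReductionChar0Parts.lean`)
— needs no Hironaka but three inputs that are not yet named facts; it is recorded there.
[cite: CossartPiltant2019, proof of Prop. 4.10 (arXiv v1: Prop. 4.8), first paragraph]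
[cite: Temkin2008, Thm. 1.1 and Thm. 2.3.6] -/
theorem CossartPiltant2019LUCompleteChar0_holds_of :
    Hironaka1964_local.{u} → CossartPiltant2019LUCompleteChar0.{u} :=
  fun hH => CossartPiltant2019LUCompleteChar0.of_hironaka1964_local hH

end Literature.AlgebraicGeometry.Resolution

end
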